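import Summits.Langlands.Langlands.Theorems.SqrtFiveQuarticCoversTraceDetTables
import Summits.Langlands.Langlands.Theorems.SqrtFiveQuarticCoversTraceDetTablesThree
import Summits.Langlands.Langlands.Theorems.SqrtFiveQuarticCoversTraceDetTablesSeven
import Literature.NumberTheory.GaloisRepresentations.GaloisRep
import Literature.NumberTheory.EllipticCurves.GaloisAction

/-!
# Framing-level negations from Frobenius `(trace, det)`-witnesses — the shapes the five certificates carry
# (route `SqrtFiveQuarticCovers`, cell `pub/lg-quartmod`, F-L1 assembly at width; for typ-1/2/3)

The certificate hypotheses `hA … hE` of `refinedLocusModular_of_certificates` (p653708) — the split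
children `CertB3H8`, `CertH12B7`, `CertS3H8`, `CertB3E7`, `CertS3H12` — carry their level structures in
the route's FRAMING form: `∃ ρ̄ : FramedGaloisRep K (ZMod ℓ) 2, (ρ̄ frames E[ℓ]) ∧ (∀ σ, ρ̄ σ ∈ H)` (or
`(ρ̄ σ)₁₀ = 0` for Borel), with no conjugating element.  A typist who disposes of an exceptional class
by a Frobenius argument (e.g. orbit B of `X(b3,H8)`: four non-CM points over the totally real
`K₁ = ℚ(θ)`, `θ⁴ − 35θ² + 205`, «large at 7») holds a witness statement quantified over ALL framings
(trace and determinant of `ρ̄(Frob_𝔓)` do not depend on the framing) and needs the NEGATION of the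
framing-form clause.  This file is that one-step glue, per prime and per subgroup, over the
kernel-checked kill-lemmas of `SqrtFiveQuarticCoversTraceDetTables{,Three,Seven}` (eng-7 g2):

* `ℓ = 7`: `not_framing_borel7_or_Ge7_of_witnesses` (flags `W7b + W7ns` ⇒ `¬ ((∃ρ̄, Borel) ∨ (∃ρ̄, G(e7)))`,
  literally the negation of the 7-hypothesis of `hA` / `CertB3H8`), `not_framing_Ge7_of_witness_split`,
  `not_framing_borel7_or_Ge7_of_witness` (one element: `det ∈ {3,5,6}`, `tr ≠ 0`, non-square disc);
* `ℓ = 5`: `not_framing_H8_of_witness_det_one` (`det 1`, `tr = ±1`), `not_framing_H12_of_witness_det_one`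
  (`det 1`, `tr = 0`), `not_framing_H8_of_witness` / `not_framing_H12_of_witness` (`det = −1`, `tr ≠ 0`);
* `ℓ = 3`: `not_framing_borel3_or_Cs3_of_witness` (`det 2`, `tr ≠ 0`);
* any `ℓ`-shape at `3, 5, 7`: `not_framing_borel_of_witness` stated at `7` and `5` (non-square disc).

Pure logic over finite group theory; no definitions; standard axioms; `K` any field that is a number
field, `E` any integral Weierstrass model (no `Δ ≠ 0` needed).  HONEST: nothing here is a statement
about any particular curve; the witness hypotheses are discharged by the users' named Frobenius facts
(dictionary `(N𝔓, a_𝔓) ↦ (det, trace)`); nothing here proves modularity.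
-/

set_option linter.dupNamespace false -- project-wide option (lakefile weak.linter.dupNamespace); `Summit.Langlands.Langlands` is the mandated namespace

namespace Summit.Langlands.Langlands.Theorems.SqrtFiveQuarticCovers

open scoped Matrix

/-! ## `ℓ = 7` -/

/-- **Flags `W7b + W7ns` ⇒ no framing of `E[7]` is Borel and none lands in `G(e7)`** — literally the
negation of the mod-`7` hypothesis of `CertB3H8` (`hA`).  Witnesses, for EVERY framing: one `ρ̄(σ)` with
non-square `trace² − 4 det`, one `ρ̄(σ')` with non-zero trace and non-zero square `trace² − 4 det`.
From `not_borel_or_conj_Ge7_of_witnesses` at `G = range ρ̄`, `x = 1`. [folklore] -/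
theorem not_framing_borel7_or_Ge7_of_witnesses
    {K : Type} [Field K] [NumberField K] {E : WeierstrassCurve (NumberField.RingOfIntegers K)}
    (hw : ∀ ρ : Literature.NumberTheory.GaloisRepresentations.FramedGaloisRep K (ZMod 7) 2,
        (∃ e : (E.baseChange K).geomTorsion ((7 : ℕ) : ℤ) ≃+ (Fin 2 → ZMod 7),
          ∀ (σ : Field.absoluteGaloisGroup K) (P : (E.baseChange K).geomTorsion ((7 : ℕ) : ℤ)),
            e (σ • P) = ((ρ σ : GL (Fin 2) (ZMod 7)) : Matrix (Fin 2) (Fin 2) (ZMod 7)) *ᵥ (e P)) →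
        (∃ σ : Field.absoluteGaloisGroup K,
          ¬ IsSquare (Matrix.trace ((ρ σ : GL (Fin 2) (ZMod 7)) : Matrix (Fin 2) (Fin 2) (ZMod 7)) ^ 2 -
            4 * Matrix.det ((ρ σ : GL (Fin 2) (ZMod 7)) : Matrix (Fin 2) (Fin 2) (ZMod 7)))) ∧
        (∃ σ : Field.absoluteGaloisGroup K,
          Matrix.trace ((ρ σ : GL (Fin 2) (ZMod 7)) : Matrix (Fin 2) (Fin 2) (ZMod 7)) ≠ 0 ∧
          IsSquare (Matrix.trace ((ρ σ : GL (Fin 2) (ZMod 7)) : Matrix (Fin 2) (Fin 2) (ZMod 7)) ^ 2 -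
            4 * Matrix.det ((ρ σ : GL (Fin 2) (ZMod 7)) : Matrix (Fin 2) (Fin 2) (ZMod 7))) ∧
          Matrix.trace ((ρ σ : GL (Fin 2) (ZMod 7)) : Matrix (Fin 2) (Fin 2) (ZMod 7)) ^ 2 -
            4 * Matrix.det ((ρ σ : GL (Fin 2) (ZMod 7)) : Matrix (Fin 2) (Fin 2) (ZMod 7)) ≠ 0)) :
    ¬ ((∃ ρ : Literature.NumberTheory.GaloisRepresentations.FramedGaloisRep K (ZMod 7) 2,
        (∃ e : (E.baseChange K).geomTorsion ((7 : ℕ) : ℤ) ≃+ (Fin 2 → ZMod 7),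
          ∀ (σ : Field.absoluteGaloisGroup K) (P : (E.baseChange K).geomTorsion ((7 : ℕ) : ℤ)),
            e (σ • P) = ((ρ σ : GL (Fin 2) (ZMod 7)) : Matrix (Fin 2) (Fin 2) (ZMod 7)) *ᵥ (e P)) ∧
        (∀ σ : Field.absoluteGaloisGroup K, (((ρ σ : GL (Fin 2) (ZMod 7)) : Matrix (Fin 2) (Fin 2) (ZMod 7))) 1 0 = 0)) ∨
      (∃ ρ : Literature.NumberTheory.GaloisRepresentations.FramedGaloisRep K (ZMod 7) 2,
        (∃ e : (E.baseChange K).geomTorsion ((7 : ℕ) : ℤ) ≃+ (Fin 2 → ZMod 7),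
          ∀ (σ : Field.absoluteGaloisGroup K) (P : (E.baseChange K).geomTorsion ((7 : ℕ) : ℤ)),
            e (σ • P) = ((ρ σ : GL (Fin 2) (ZMod 7)) : Matrix (Fin 2) (Fin 2) (ZMod 7)) *ᵥ (e P)) ∧
        (∀ σ : Field.absoluteGaloisGroup K, (ρ σ : GL (Fin 2) (ZMod 7)) ∈ Subgroup.closure ({(⟨!![0, 5; 3, 0], !![0, 5; 3, 0], by decide, by decide⟩ : GL (Fin 2) (ZMod 7)), (⟨!![5, 0; 3, 2], !![3, 0; 6, 4], by decide, by decide⟩ : GL (Fin 2) (ZMod 7))} : Set (GL (Fin 2) (ZMod 7)))))) := by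
  rintro (⟨ρ, hρ, h⟩ | ⟨ρ, hρ, h⟩) <;>
    obtain ⟨⟨σ, hns⟩, σ', ht', hD', hD0'⟩ := hw ρ hρ
  · refine not_borel_or_conj_Ge7_of_witnesses (G := ρ.toMonoidHom.range) (g := ρ σ) (g' := ρ σ')
      ⟨σ, rfl⟩ hns ⟨σ', rfl⟩ ht' hD' hD0' ⟨1, Or.inl ?_⟩
    rintro _ ⟨τ, rfl⟩; rw [one_mul, inv_one, mul_one]; exact h τ
  · refine not_borel_or_conj_Ge7_of_witnesses (G := ρ.toMonoidHom.range) (g := ρ σ) (g' := ρ σ')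
      ⟨σ, rfl⟩ hns ⟨σ', rfl⟩ ht' hD' hD0' ⟨1, Or.inr ?_⟩
    rintro _ ⟨τ, rfl⟩; rw [one_mul, inv_one, mul_one]; exact h τ

/-- **Flag `W7ns` alone ⇒ no framing of `E[7]` lands in `G(e7)`**: for every framing some `ρ̄(σ)` has
non-zero trace and non-zero square discriminant (`not_conj_Ge7_of_witness_split`). [folklore] -/
theorem not_framing_Ge7_of_witness_split
    {K : Type} [Field K] [NumberField K] {E : WeierstrassCurve (NumberField.RingOfIntegers K)}
    (hw : ∀ ρ : Literature.NumberTheory.GaloisRepresentations.FramedGaloisRep K (ZMod 7) 2,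
        (∃ e : (E.baseChange K).geomTorsion ((7 : ℕ) : ℤ) ≃+ (Fin 2 → ZMod 7),
          ∀ (σ : Field.absoluteGaloisGroup K) (P : (E.baseChange K).geomTorsion ((7 : ℕ) : ℤ)),
            e (σ • P) = ((ρ σ : GL (Fin 2) (ZMod 7)) : Matrix (Fin 2) (Fin 2) (ZMod 7)) *ᵥ (e P)) →
        ∃ σ : Field.absoluteGaloisGroup K,
          Matrix.trace ((ρ σ : GL (Fin 2) (ZMod 7)) : Matrix (Fin 2) (Fin 2) (ZMod 7)) ≠ 0 ∧
          IsSquare (Matrix.trace ((ρ σ : GL (Fin 2) (ZMod 7)) : Matrix (Fin 2) (Fin 2) (ZMod 7)) ^ 2 -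
            4 * Matrix.det ((ρ σ : GL (Fin 2) (ZMod 7)) : Matrix (Fin 2) (Fin 2) (ZMod 7))) ∧
          Matrix.trace ((ρ σ : GL (Fin 2) (ZMod 7)) : Matrix (Fin 2) (Fin 2) (ZMod 7)) ^ 2 -
            4 * Matrix.det ((ρ σ : GL (Fin 2) (ZMod 7)) : Matrix (Fin 2) (Fin 2) (ZMod 7)) ≠ 0) :
    ¬ (∃ ρ : Literature.NumberTheory.GaloisRepresentations.FramedGaloisRep K (ZMod 7) 2,
        (∃ e : (E.baseChange K).geomTorsion ((7 : ℕ) : ℤ) ≃+ (Fin 2 → ZMod 7),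
          ∀ (σ : Field.absoluteGaloisGroup K) (P : (E.baseChange K).geomTorsion ((7 : ℕ) : ℤ)),
            e (σ • P) = ((ρ σ : GL (Fin 2) (ZMod 7)) : Matrix (Fin 2) (Fin 2) (ZMod 7)) *ᵥ (e P)) ∧
        (∀ σ : Field.absoluteGaloisGroup K, (ρ σ : GL (Fin 2) (ZMod 7)) ∈ Subgroup.closure ({(⟨!![0, 5; 3, 0], !![0, 5; 3, 0], by decide, by decide⟩ : GL (Fin 2) (ZMod 7)), (⟨!![5, 0; 3, 2], !![3, 0; 6, 4], by decide, by decide⟩ : GL (Fin 2) (ZMod 7))} : Set (GL (Fin 2) (ZMod 7))))) := by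
  rintro ⟨ρ, hρ, h⟩
  obtain ⟨σ, ht, hD, hD0⟩ := hw ρ hρ
  refine not_conj_Ge7_of_witness_split (G := ρ.toMonoidHom.range) (g := ρ σ) ⟨σ, rfl⟩ ht hD hD0 ⟨1, ?_⟩
  rintro _ ⟨τ, rfl⟩; rw [one_mul, inv_one, mul_one]; exact h τ

/-- **«Large at 7» from ONE element ⇒ no framing is Borel, none lands in `G(e7)`**: for every framing
some `ρ̄(σ)` has `det ∈ {3, 5, 6}`, non-zero trace and non-square discriminant
(`not_borel_or_conj_Ge7_of_witness`). [folklore] -/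
theorem not_framing_borel7_or_Ge7_of_witness
    {K : Type} [Field K] [NumberField K] {E : WeierstrassCurve (NumberField.RingOfIntegers K)}
    (hw : ∀ ρ : Literature.NumberTheory.GaloisRepresentations.FramedGaloisRep K (ZMod 7) 2,
        (∃ e : (E.baseChange K).geomTorsion ((7 : ℕ) : ℤ) ≃+ (Fin 2 → ZMod 7),
          ∀ (σ : Field.absoluteGaloisGroup K) (P : (E.baseChange K).geomTorsion ((7 : ℕ) : ℤ)),
            e (σ • P) = ((ρ σ : GL (Fin 2) (ZMod 7)) : Matrix (Fin 2) (Fin 2) (ZMod 7)) *ᵥ (e P)) →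
        ∃ σ : Field.absoluteGaloisGroup K,
          (Matrix.det ((ρ σ : GL (Fin 2) (ZMod 7)) : Matrix (Fin 2) (Fin 2) (ZMod 7)) = 3 ∨
            Matrix.det ((ρ σ : GL (Fin 2) (ZMod 7)) : Matrix (Fin 2) (Fin 2) (ZMod 7)) = 5 ∨
            Matrix.det ((ρ σ : GL (Fin 2) (ZMod 7)) : Matrix (Fin 2) (Fin 2) (ZMod 7)) = 6) ∧
          Matrix.trace ((ρ σ : GL (Fin 2) (ZMod 7)) : Matrix (Fin 2) (Fin 2) (ZMod 7)) ≠ 0 ∧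
          ¬ IsSquare (Matrix.trace ((ρ σ : GL (Fin 2) (ZMod 7)) : Matrix (Fin 2) (Fin 2) (ZMod 7)) ^ 2 -
            4 * Matrix.det ((ρ σ : GL (Fin 2) (ZMod 7)) : Matrix (Fin 2) (Fin 2) (ZMod 7)))) :
    ¬ ((∃ ρ : Literature.NumberTheory.GaloisRepresentations.FramedGaloisRep K (ZMod 7) 2,
        (∃ e : (E.baseChange K).geomTorsion ((7 : ℕ) : ℤ) ≃+ (Fin 2 → ZMod 7),
          ∀ (σ : Field.absoluteGaloisGroup K) (P : (E.baseChange K).geomTorsion ((7 : ℕ) : ℤ)),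
            e (σ • P) = ((ρ σ : GL (Fin 2) (ZMod 7)) : Matrix (Fin 2) (Fin 2) (ZMod 7)) *ᵥ (e P)) ∧
        (∀ σ : Field.absoluteGaloisGroup K, (((ρ σ : GL (Fin 2) (ZMod 7)) : Matrix (Fin 2) (Fin 2) (ZMod 7))) 1 0 = 0)) ∨
      (∃ ρ : Literature.NumberTheory.GaloisRepresentations.FramedGaloisRep K (ZMod 7) 2,
        (∃ e : (E.baseChange K).geomTorsion ((7 : ℕ) : ℤ) ≃+ (Fin 2 → ZMod 7),
          ∀ (σ : Field.absoluteGaloisGroup K) (P : (E.baseChange K).geomTorsion ((7 : ℕ) : ℤ)),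
            e (σ • P) = ((ρ σ : GL (Fin 2) (ZMod 7)) : Matrix (Fin 2) (Fin 2) (ZMod 7)) *ᵥ (e P)) ∧
        (∀ σ : Field.absoluteGaloisGroup K, (ρ σ : GL (Fin 2) (ZMod 7)) ∈ Subgroup.closure ({(⟨!![0, 5; 3, 0], !![0, 5; 3, 0], by decide, by decide⟩ : GL (Fin 2) (ZMod 7)), (⟨!![5, 0; 3, 2], !![3, 0; 6, 4], by decide, by decide⟩ : GL (Fin 2) (ZMod 7))} : Set (GL (Fin 2) (ZMod 7)))))) := by
  rintro (⟨ρ, hρ, h⟩ | ⟨ρ, hρ, h⟩) <;> obtain ⟨σ, hd, ht, hns⟩ := hw ρ hρ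
  · refine not_borel_or_conj_Ge7_of_witness (G := ρ.toMonoidHom.range) (g := ρ σ) ⟨σ, rfl⟩ hd ht hns
      ⟨1, Or.inl ?_⟩
    rintro _ ⟨τ, rfl⟩; rw [one_mul, inv_one, mul_one]; exact h τ
  · refine not_borel_or_conj_Ge7_of_witness (G := ρ.toMonoidHom.range) (g := ρ σ) ⟨σ, rfl⟩ hd ht hns
      ⟨1, Or.inr ?_⟩
    rintro _ ⟨τ, rfl⟩; rw [one_mul, inv_one, mul_one]; exact h τ

/-- **Flag `W7b` (or `W5b`, `W3b`: any non-square discriminant) ⇒ no framing of `E[7]` is Borel**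
(`not_conj_borel_of_witness`). [folklore] -/
theorem not_framing_borel7_of_witness
    {K : Type} [Field K] [NumberField K] {E : WeierstrassCurve (NumberField.RingOfIntegers K)}
    (hw : ∀ ρ : Literature.NumberTheory.GaloisRepresentations.FramedGaloisRep K (ZMod 7) 2,
        (∃ e : (E.baseChange K).geomTorsion ((7 : ℕ) : ℤ) ≃+ (Fin 2 → ZMod 7),
          ∀ (σ : Field.absoluteGaloisGroup K) (P : (E.baseChange K).geomTorsion ((7 : ℕ) : ℤ)),
            e (σ • P) = ((ρ σ : GL (Fin 2) (ZMod 7)) : Matrix (Fin 2) (Fin 2) (ZMod 7)) *ᵥ (e P)) →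
        ∃ σ : Field.absoluteGaloisGroup K,
          ¬ IsSquare (Matrix.trace ((ρ σ : GL (Fin 2) (ZMod 7)) : Matrix (Fin 2) (Fin 2) (ZMod 7)) ^ 2 -
            4 * Matrix.det ((ρ σ : GL (Fin 2) (ZMod 7)) : Matrix (Fin 2) (Fin 2) (ZMod 7)))) :
    ¬ (∃ ρ : Literature.NumberTheory.GaloisRepresentations.FramedGaloisRep K (ZMod 7) 2,
        (∃ e : (E.baseChange K).geomTorsion ((7 : ℕ) : ℤ) ≃+ (Fin 2 → ZMod 7),
          ∀ (σ : Field.absoluteGaloisGroup K) (P : (E.baseChange K).geomTorsion ((7 : ℕ) : ℤ)),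
            e (σ • P) = ((ρ σ : GL (Fin 2) (ZMod 7)) : Matrix (Fin 2) (Fin 2) (ZMod 7)) *ᵥ (e P)) ∧
        (∀ σ : Field.absoluteGaloisGroup K, (((ρ σ : GL (Fin 2) (ZMod 7)) : Matrix (Fin 2) (Fin 2) (ZMod 7))) 1 0 = 0)) := by
  rintro ⟨ρ, hρ, h⟩
  obtain ⟨σ, hns⟩ := hw ρ hρ
  refine not_conj_borel_of_witness (G := ρ.toMonoidHom.range) (g := ρ σ) ⟨σ, rfl⟩ hns ⟨1, ?_⟩
  rintro _ ⟨τ, rfl⟩; rw [one_mul, inv_one, mul_one]; exact h τ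

/-! ## `ℓ = 5` -/

/-- **No framing of `E[5]` lands in `H8`, from a determinant-one element of trace `±1`**
(`GroupCensusFive.not_conj_H8_of_witness_det_one`; one good prime with `N𝔓 ≡ 1`, `a_𝔓 ≡ ±1 (mod 5)`).
[folklore] -/
theorem not_framing_H8_of_witness_det_one
    {K : Type} [Field K] [NumberField K] {E : WeierstrassCurve (NumberField.RingOfIntegers K)}
    (hw : ∀ ρ : Literature.NumberTheory.GaloisRepresentations.FramedGaloisRep K (ZMod 5) 2,
        (∃ e : (E.baseChange K).geomTorsion ((5 : ℕ) : ℤ) ≃+ (Fin 2 → ZMod 5),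
          ∀ (σ : Field.absoluteGaloisGroup K) (P : (E.baseChange K).geomTorsion ((5 : ℕ) : ℤ)),
            e (σ • P) = ((ρ σ : GL (Fin 2) (ZMod 5)) : Matrix (Fin 2) (Fin 2) (ZMod 5)) *ᵥ (e P)) →
        ∃ σ : Field.absoluteGaloisGroup K,
          Matrix.det ((ρ σ : GL (Fin 2) (ZMod 5)) : Matrix (Fin 2) (Fin 2) (ZMod 5)) = 1 ∧
          (Matrix.trace ((ρ σ : GL (Fin 2) (ZMod 5)) : Matrix (Fin 2) (Fin 2) (ZMod 5)) = 1 ∨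
            Matrix.trace ((ρ σ : GL (Fin 2) (ZMod 5)) : Matrix (Fin 2) (Fin 2) (ZMod 5)) = 4)) :
    ¬ (∃ ρ : Literature.NumberTheory.GaloisRepresentations.FramedGaloisRep K (ZMod 5) 2,
        (∃ e : (E.baseChange K).geomTorsion ((5 : ℕ) : ℤ) ≃+ (Fin 2 → ZMod 5),
          ∀ (σ : Field.absoluteGaloisGroup K) (P : (E.baseChange K).geomTorsion ((5 : ℕ) : ℤ)),
            e (σ • P) = ((ρ σ : GL (Fin 2) (ZMod 5)) : Matrix (Fin 2) (Fin 2) (ZMod 5)) *ᵥ (e P)) ∧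
        (∀ σ : Field.absoluteGaloisGroup K, (ρ σ : GL (Fin 2) (ZMod 5)) ∈ Subgroup.closure ({(⟨!![2, 0; 0, 3], !![3, 0; 0, 2], by decide, by decide⟩ : GL (Fin 2) (ZMod 5)), (⟨!![0, 1; 1, 0], !![0, 1; 1, 0], by decide, by decide⟩ : GL (Fin 2) (ZMod 5))} : Set (GL (Fin 2) (ZMod 5))))) := by
  rintro ⟨ρ, hρ, h⟩
  obtain ⟨σ, hd, ht⟩ := hw ρ hρ
  refine GroupCensusFive.not_conj_H8_of_witness_det_one (G := ρ.toMonoidHom.range) (g := ρ σ) ⟨σ, rfl⟩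
    hd ht ⟨1, ?_⟩
  rintro _ ⟨τ, rfl⟩; rw [one_mul, inv_one, mul_one]; exact h τ

/-- **No framing of `E[5]` lands in `H12`, from a determinant-one element of trace `0`**
(`GroupCensusFive.not_conj_H12_of_witness_det_one`; one good prime with `N𝔓 ≡ 1`, `a_𝔓 ≡ 0 (mod 5)` —
the cell's flag `W5H12` at `d = 1`, e.g. eng-8's `𝔓 ∣ 11` for the eleventh exceptional class). [folklore] -/
theorem not_framing_H12_of_witness_det_one
    {K : Type} [Field K] [NumberField K] {E : WeierstrassCurve (NumberField.RingOfIntegers K)}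
    (hw : ∀ ρ : Literature.NumberTheory.GaloisRepresentations.FramedGaloisRep K (ZMod 5) 2,
        (∃ e : (E.baseChange K).geomTorsion ((5 : ℕ) : ℤ) ≃+ (Fin 2 → ZMod 5),
          ∀ (σ : Field.absoluteGaloisGroup K) (P : (E.baseChange K).geomTorsion ((5 : ℕ) : ℤ)),
            e (σ • P) = ((ρ σ : GL (Fin 2) (ZMod 5)) : Matrix (Fin 2) (Fin 2) (ZMod 5)) *ᵥ (e P)) →
        ∃ σ : Field.absoluteGaloisGroup K,
          Matrix.det ((ρ σ : GL (Fin 2) (ZMod 5)) : Matrix (Fin 2) (Fin 2) (ZMod 5)) = 1 ∧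
          Matrix.trace ((ρ σ : GL (Fin 2) (ZMod 5)) : Matrix (Fin 2) (Fin 2) (ZMod 5)) = 0) :
    ¬ (∃ ρ : Literature.NumberTheory.GaloisRepresentations.FramedGaloisRep K (ZMod 5) 2,
        (∃ e : (E.baseChange K).geomTorsion ((5 : ℕ) : ℤ) ≃+ (Fin 2 → ZMod 5),
          ∀ (σ : Field.absoluteGaloisGroup K) (P : (E.baseChange K).geomTorsion ((5 : ℕ) : ℤ)),
            e (σ • P) = ((ρ σ : GL (Fin 2) (ZMod 5)) : Matrix (Fin 2) (Fin 2) (ZMod 5)) *ᵥ (e P)) ∧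
        (∀ σ : Field.absoluteGaloisGroup K, (ρ σ : GL (Fin 2) (ZMod 5)) ∈ Subgroup.closure ({(⟨!![3, 1; 3, 3], !![3, 4; 2, 3], by decide, by decide⟩ : GL (Fin 2) (ZMod 5)), (⟨!![1, 0; 0, 4], !![1, 0; 0, 4], by decide, by decide⟩ : GL (Fin 2) (ZMod 5))} : Set (GL (Fin 2) (ZMod 5))))) := by
  rintro ⟨ρ, hρ, h⟩
  obtain ⟨σ, hd, ht⟩ := hw ρ hρ
  refine GroupCensusFive.not_conj_H12_of_witness_det_one (G := ρ.toMonoidHom.range) (g := ρ σ) ⟨σ, rfl⟩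
    hd ht ⟨1, ?_⟩
  rintro _ ⟨τ, rfl⟩; rw [one_mul, inv_one, mul_one]; exact h τ

/-- **No framing of `E[5]` lands in `H8`, from an element of determinant `−1` and non-zero trace**
(`GroupCensusFive.not_conj_H8_or_H12_of_witness`, `H8` half). [folklore] -/
theorem not_framing_H8_of_witness
    {K : Type} [Field K] [NumberField K] {E : WeierstrassCurve (NumberField.RingOfIntegers K)}
    (hw : ∀ ρ : Literature.NumberTheory.GaloisRepresentations.FramedGaloisRep K (ZMod 5) 2,
        (∃ e : (E.baseChange K).geomTorsion ((5 : ℕ) : ℤ) ≃+ (Fin 2 → ZMod 5),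
          ∀ (σ : Field.absoluteGaloisGroup K) (P : (E.baseChange K).geomTorsion ((5 : ℕ) : ℤ)),
            e (σ • P) = ((ρ σ : GL (Fin 2) (ZMod 5)) : Matrix (Fin 2) (Fin 2) (ZMod 5)) *ᵥ (e P)) →
        ∃ σ : Field.absoluteGaloisGroup K,
          Matrix.det ((ρ σ : GL (Fin 2) (ZMod 5)) : Matrix (Fin 2) (Fin 2) (ZMod 5)) = -1 ∧
          Matrix.trace ((ρ σ : GL (Fin 2) (ZMod 5)) : Matrix (Fin 2) (Fin 2) (ZMod 5)) ≠ 0) :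
    ¬ (∃ ρ : Literature.NumberTheory.GaloisRepresentations.FramedGaloisRep K (ZMod 5) 2,
        (∃ e : (E.baseChange K).geomTorsion ((5 : ℕ) : ℤ) ≃+ (Fin 2 → ZMod 5),
          ∀ (σ : Field.absoluteGaloisGroup K) (P : (E.baseChange K).geomTorsion ((5 : ℕ) : ℤ)),
            e (σ • P) = ((ρ σ : GL (Fin 2) (ZMod 5)) : Matrix (Fin 2) (Fin 2) (ZMod 5)) *ᵥ (e P)) ∧
        (∀ σ : Field.absoluteGaloisGroup K, (ρ σ : GL (Fin 2) (ZMod 5)) ∈ Subgroup.closure ({(⟨!![2, 0; 0, 3], !![3, 0; 0, 2], by decide, by decide⟩ : GL (Fin 2) (ZMod 5)), (⟨!![0, 1; 1, 0], !![0, 1; 1, 0], by decide, by decide⟩ : GL (Fin 2) (ZMod 5))} : Set (GL (Fin 2) (ZMod 5))))) := by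
  rintro ⟨ρ, hρ, h⟩
  obtain ⟨σ, hd, ht⟩ := hw ρ hρ
  refine GroupCensusFive.not_conj_H8_or_H12_of_witness (G := ρ.toMonoidHom.range) (g := ρ σ) ⟨σ, rfl⟩
    hd ht ⟨1, Or.inl ?_⟩
  rintro _ ⟨τ, rfl⟩; rw [one_mul, inv_one, mul_one]; exact h τ

/-- **No framing of `E[5]` lands in `H12`, from an element of determinant `−1` and non-zero trace**
(`GroupCensusFive.not_conj_H8_or_H12_of_witness`, `H12` half). [folklore] -/
theorem not_framing_H12_of_witness
    {K : Type} [Field K] [NumberField K] {E : WeierstrassCurve (NumberField.RingOfIntegers K)}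
    (hw : ∀ ρ : Literature.NumberTheory.GaloisRepresentations.FramedGaloisRep K (ZMod 5) 2,
        (∃ e : (E.baseChange K).geomTorsion ((5 : ℕ) : ℤ) ≃+ (Fin 2 → ZMod 5),
          ∀ (σ : Field.absoluteGaloisGroup K) (P : (E.baseChange K).geomTorsion ((5 : ℕ) : ℤ)),
            e (σ • P) = ((ρ σ : GL (Fin 2) (ZMod 5)) : Matrix (Fin 2) (Fin 2) (ZMod 5)) *ᵥ (e P)) →
        ∃ σ : Field.absoluteGaloisGroup K,
          Matrix.det ((ρ σ : GL (Fin 2) (ZMod 5)) : Matrix (Fin 2) (Fin 2) (ZMod 5)) = -1 ∧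
          Matrix.trace ((ρ σ : GL (Fin 2) (ZMod 5)) : Matrix (Fin 2) (Fin 2) (ZMod 5)) ≠ 0) :
    ¬ (∃ ρ : Literature.NumberTheory.GaloisRepresentations.FramedGaloisRep K (ZMod 5) 2,
        (∃ e : (E.baseChange K).geomTorsion ((5 : ℕ) : ℤ) ≃+ (Fin 2 → ZMod 5),
          ∀ (σ : Field.absoluteGaloisGroup K) (P : (E.baseChange K).geomTorsion ((5 : ℕ) : ℤ)),
            e (σ • P) = ((ρ σ : GL (Fin 2) (ZMod 5)) : Matrix (Fin 2) (Fin 2) (ZMod 5)) *ᵥ (e P)) ∧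
        (∀ σ : Field.absoluteGaloisGroup K, (ρ σ : GL (Fin 2) (ZMod 5)) ∈ Subgroup.closure ({(⟨!![3, 1; 3, 3], !![3, 4; 2, 3], by decide, by decide⟩ : GL (Fin 2) (ZMod 5)), (⟨!![1, 0; 0, 4], !![1, 0; 0, 4], by decide, by decide⟩ : GL (Fin 2) (ZMod 5))} : Set (GL (Fin 2) (ZMod 5))))) := by
  rintro ⟨ρ, hρ, h⟩
  obtain ⟨σ, hd, ht⟩ := hw ρ hρ
  refine GroupCensusFive.not_conj_H8_or_H12_of_witness (G := ρ.toMonoidHom.range) (g := ρ σ) ⟨σ, rfl⟩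
    hd ht ⟨1, Or.inr ?_⟩
  rintro _ ⟨τ, rfl⟩; rw [one_mul, inv_one, mul_one]; exact h τ

/-- **No framing of `E[5]` is Borel, from an element with non-square discriminant**
(`not_conj_borel_of_witness` at `5`). [folklore] -/
theorem not_framing_borel5_of_witness
    {K : Type} [Field K] [NumberField K] {E : WeierstrassCurve (NumberField.RingOfIntegers K)}
    (hw : ∀ ρ : Literature.NumberTheory.GaloisRepresentations.FramedGaloisRep K (ZMod 5) 2,
        (∃ e : (E.baseChange K).geomTorsion ((5 : ℕ) : ℤ) ≃+ (Fin 2 → ZMod 5),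
          ∀ (σ : Field.absoluteGaloisGroup K) (P : (E.baseChange K).geomTorsion ((5 : ℕ) : ℤ)),
            e (σ • P) = ((ρ σ : GL (Fin 2) (ZMod 5)) : Matrix (Fin 2) (Fin 2) (ZMod 5)) *ᵥ (e P)) →
        ∃ σ : Field.absoluteGaloisGroup K,
          ¬ IsSquare (Matrix.trace ((ρ σ : GL (Fin 2) (ZMod 5)) : Matrix (Fin 2) (Fin 2) (ZMod 5)) ^ 2 -
            4 * Matrix.det ((ρ σ : GL (Fin 2) (ZMod 5)) : Matrix (Fin 2) (Fin 2) (ZMod 5)))) :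
    ¬ (∃ ρ : Literature.NumberTheory.GaloisRepresentations.FramedGaloisRep K (ZMod 5) 2,
        (∃ e : (E.baseChange K).geomTorsion ((5 : ℕ) : ℤ) ≃+ (Fin 2 → ZMod 5),
          ∀ (σ : Field.absoluteGaloisGroup K) (P : (E.baseChange K).geomTorsion ((5 : ℕ) : ℤ)),
            e (σ • P) = ((ρ σ : GL (Fin 2) (ZMod 5)) : Matrix (Fin 2) (Fin 2) (ZMod 5)) *ᵥ (e P)) ∧
        (∀ σ : Field.absoluteGaloisGroup K, (((ρ σ : GL (Fin 2) (ZMod 5)) : Matrix (Fin 2) (Fin 2) (ZMod 5))) 1 0 = 0)) := by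
  rintro ⟨ρ, hρ, h⟩
  obtain ⟨σ, hns⟩ := hw ρ hρ
  refine not_conj_borel_of_witness (G := ρ.toMonoidHom.range) (g := ρ σ) ⟨σ, rfl⟩ hns ⟨1, ?_⟩
  rintro _ ⟨τ, rfl⟩; rw [one_mul, inv_one, mul_one]; exact h τ

/-! ## `ℓ = 3` -/

/-- **«Large at 3» ⇒ no framing of `E[3]` is Borel and none lands in `C_s⁺(3)`**: for every framing
some `ρ̄(σ)` has determinant `2` and non-zero trace (`not_borel_or_conj_Cs3_of_witness`). [folklore] -/
theorem not_framing_borel3_or_Cs3_of_witness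
    {K : Type} [Field K] [NumberField K] {E : WeierstrassCurve (NumberField.RingOfIntegers K)}
    (hw : ∀ ρ : Literature.NumberTheory.GaloisRepresentations.FramedGaloisRep K (ZMod 3) 2,
        (∃ e : (E.baseChange K).geomTorsion ((3 : ℕ) : ℤ) ≃+ (Fin 2 → ZMod 3),
          ∀ (σ : Field.absoluteGaloisGroup K) (P : (E.baseChange K).geomTorsion ((3 : ℕ) : ℤ)),
            e (σ • P) = ((ρ σ : GL (Fin 2) (ZMod 3)) : Matrix (Fin 2) (Fin 2) (ZMod 3)) *ᵥ (e P)) →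
        ∃ σ : Field.absoluteGaloisGroup K,
          Matrix.det ((ρ σ : GL (Fin 2) (ZMod 3)) : Matrix (Fin 2) (Fin 2) (ZMod 3)) = 2 ∧
          Matrix.trace ((ρ σ : GL (Fin 2) (ZMod 3)) : Matrix (Fin 2) (Fin 2) (ZMod 3)) ≠ 0) :
    ¬ ((∃ ρ : Literature.NumberTheory.GaloisRepresentations.FramedGaloisRep K (ZMod 3) 2,
        (∃ e : (E.baseChange K).geomTorsion ((3 : ℕ) : ℤ) ≃+ (Fin 2 → ZMod 3),
          ∀ (σ : Field.absoluteGaloisGroup K) (P : (E.baseChange K).geomTorsion ((3 : ℕ) : ℤ)),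
            e (σ • P) = ((ρ σ : GL (Fin 2) (ZMod 3)) : Matrix (Fin 2) (Fin 2) (ZMod 3)) *ᵥ (e P)) ∧
        (∀ σ : Field.absoluteGaloisGroup K, (((ρ σ : GL (Fin 2) (ZMod 3)) : Matrix (Fin 2) (Fin 2) (ZMod 3))) 1 0 = 0)) ∨
      (∃ ρ : Literature.NumberTheory.GaloisRepresentations.FramedGaloisRep K (ZMod 3) 2,
        (∃ e : (E.baseChange K).geomTorsion ((3 : ℕ) : ℤ) ≃+ (Fin 2 → ZMod 3),
          ∀ (σ : Field.absoluteGaloisGroup K) (P : (E.baseChange K).geomTorsion ((3 : ℕ) : ℤ)),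
            e (σ • P) = ((ρ σ : GL (Fin 2) (ZMod 3)) : Matrix (Fin 2) (Fin 2) (ZMod 3)) *ᵥ (e P)) ∧
        (∀ σ : Field.absoluteGaloisGroup K, (ρ σ : GL (Fin 2) (ZMod 3)) ∈ Subgroup.closure ({(⟨!![1, 0; 0, 2], !![1, 0; 0, 2], by decide, by decide⟩ : GL (Fin 2) (ZMod 3)), (⟨!![0, 1; 1, 0], !![0, 1; 1, 0], by decide, by decide⟩ : GL (Fin 2) (ZMod 3))} : Set (GL (Fin 2) (ZMod 3)))))) := by
  rintro (⟨ρ, hρ, h⟩ | ⟨ρ, hρ, h⟩) <;> obtain ⟨σ, hd, ht⟩ := hw ρ hρ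
  · refine not_borel_or_conj_Cs3_of_witness (G := ρ.toMonoidHom.range) (g := ρ σ) ⟨σ, rfl⟩ hd ht
      ⟨1, Or.inl ?_⟩
    rintro _ ⟨τ, rfl⟩; rw [one_mul, inv_one, mul_one]; exact h τ
  · refine not_borel_or_conj_Cs3_of_witness (G := ρ.toMonoidHom.range) (g := ρ σ) ⟨σ, rfl⟩ hd ht
      ⟨1, Or.inr ?_⟩
    rintro _ ⟨τ, rfl⟩; rw [one_mul, inv_one, mul_one]; exact h τ

end Summit.Langlands.Langlands.Theorems.SqrtFiveQuarticCovers
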